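import Summits.Parity.GeneralizedHardyLittlewood.Theorems.FordMaynardSieveConst01651SieveConst01651EntryRegion
import Summits.Parity.GeneralizedHardyLittlewood.Theorems.FordMaynardSieveConst01651SieveConst01651CertRectsCheck
import Summits.Parity.GeneralizedHardyLittlewood.Theorems.FordMaynardSieveConst01651SieveConst01651CertRectsDisjoint
import Summits.Parity.GeneralizedHardyLittlewood.Theorems.FordMaynardSieveConst01651SieveConst01651DisjointSum
import Summits.Parity.GeneralizedHardyLittlewood.Theorems.FordMaynardSieveConst01651SieveConst01651PlaneNullLines
import HarnessLib

/-!
# Route `FordMaynardSieveConst01651`, target `SieveConst01651` (stmt-Parity-19185), stub `stub_certValuePos` (R2):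
# a positive `g₂` entry — the inner rectangles give a lower bound

Def-free helper file (glue (Ga) of the `certP`/`certN` soundness, see `…CertAssembly`).  For a table entry
`e = (a, b, j, c)` with `c > 0`: every inner grid rectangle `[u₀,u₁)×[v₀,v₁) / J` of `entryRects a b j true` lies in
the region `S_e` off the null lines `y₁ = e_a`, `y₂ = e_b`, `y₁ + y₂ = c₀` (`…CertRectsCheck.certRects_spec`); the
rectangles are pairwise box-disjoint (`…CertRectsDisjoint`), so the rectangle integrals of the truncated weight `f ≥ 0`
add up to at most `∫_{S_e} f` (`entryRects_integral_sum_le`, via `…DisjointSum.sum_setIntegral_le_of_subset`), and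
with `…RectSound.rectPos_sound` and `∫_{S_e} f = σ_e ∫_{Q_e} f` (`…EntryRegion`) the entry's contribution to `certP`
is at most `D` times its plane pairing (`entry_pos_sum_le`).

References: folklore; [FordMaynard2024PrimeSieves] arXiv:2407.14368, §8.2.
-/

noncomputable section

open MeasureTheory Set
open scoped Classical
open Literature.NumberTheory.Sieve Literature.NumberTheory.Sieve.FordMaynard
open Literature.Analysis.Convolution

namespace Summit.Parity.GeneralizedHardyLittlewood.FordMaynardSieveConst01651SieveConst01651

/-! ### Rectangles -/

/-- Box-separated grid rectangles are disjoint (half-open boxes). [folklore] -/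
theorem rect_disjoint_of_sep {r s : ℕ × ℕ × ℕ × ℕ}
    (h : r.2.1 ≤ s.1 ∨ s.2.1 ≤ r.1 ∨ r.2.2.2 ≤ s.2.2.1 ∨ s.2.2.2 ≤ r.2.2.1) :
    Disjoint (Set.Ico ((r.1 : ℝ) / tabJ) ((r.2.1 : ℝ) / tabJ) ×ˢ Set.Ico ((r.2.2.1 : ℝ) / tabJ) ((r.2.2.2 : ℝ) / tabJ))
      (Set.Ico ((s.1 : ℝ) / tabJ) ((s.2.1 : ℝ) / tabJ) ×ˢ Set.Ico ((s.2.2.1 : ℝ) / tabJ) ((s.2.2.2 : ℝ) / tabJ)) := by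
  have hJ : (0 : ℝ) < tabJ := by norm_num [tabJ]
  rw [Set.disjoint_left]
  intro p hp hq
  obtain ⟨⟨h1, h2⟩, ⟨h3, h4⟩⟩ := hp
  obtain ⟨⟨g1, g2⟩, ⟨g3, g4⟩⟩ := hq
  rcases h with h | h | h | h
  · have : ((r.2.1 : ℕ) : ℝ) / tabJ ≤ ((s.1 : ℕ) : ℝ) / tabJ :=
      div_le_div_of_nonneg_right (by exact_mod_cast h) hJ.le
    linarith
  · have : ((s.2.1 : ℕ) : ℝ) / tabJ ≤ ((r.1 : ℕ) : ℝ) / tabJ :=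
      div_le_div_of_nonneg_right (by exact_mod_cast h) hJ.le
    linarith
  · have : ((r.2.2.2 : ℕ) : ℝ) / tabJ ≤ ((s.2.2.1 : ℕ) : ℝ) / tabJ :=
      div_le_div_of_nonneg_right (by exact_mod_cast h) hJ.le
    linarith
  · have : ((s.2.2.2 : ℕ) : ℝ) / tabJ ≤ ((r.2.2.1 : ℕ) : ℝ) / tabJ :=
      div_le_div_of_nonneg_right (by exact_mod_cast h) hJ.le
    linarith

/-- **An inner rectangle of a positive entry lies in `S_e` off three null lines**, so its integral equals the
integral over its part inside `S_e`. [folklore] -/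
theorem rect_integral_eq_inter {e : ℕ × ℕ × ℕ × ℤ} (he : e ∈ certG2) (hc : 0 < e.2.2.2)
    {r : ℕ × ℕ × ℕ × ℕ} (hr : r ∈ entryRects e.1 e.2.1 e.2.2.1 true) :
    ∫ y in (Set.Ico ((r.1 : ℝ) / tabJ) ((r.2.1 : ℝ) / tabJ) ×ˢ Set.Ico ((r.2.2.1 : ℝ) / tabJ) ((r.2.2.2 : ℝ) / tabJ)),
          (if 0 ≤ y.1 + y.2 ∧ y.1 + y.2 ≤ 1 then ∑ k ∈ Finset.Icc 1 6, (1 / (k.factorial : ℝ)) *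
            cpow (fun t : ℝ => if (1651 / 10000 : ℝ) < t then 1 / t else 0) k (1 - (y.1 + y.2)) else 0) /
            (y.1 * y.2) ∂((volume : Measure ℝ).prod volume) =
    ∫ y in (Set.Ico ((r.1 : ℝ) / tabJ) ((r.2.1 : ℝ) / tabJ) ×ˢ Set.Ico ((r.2.2.1 : ℝ) / tabJ) ((r.2.2.2 : ℝ) / tabJ)) ∩
        {y : ℝ × ℝ | ((certEdge e.1 : ℚ) : ℝ) < y.1 ∧ y.1 < ((certEdge (e.1 + 1) : ℚ) : ℝ) ∧
      ((certEdge e.2.1 : ℚ) : ℝ) < y.2 ∧ y.2 < ((certEdge (e.2.1 + 1) : ℚ) : ℝ) ∧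
      (if e.2.2.1 = 0 then y.1 + y.2 < 8349 / 20000 else 8349 / 20000 < y.1 + y.2) ∧ y.1 + y.2 < 1 / 2},
          (if 0 ≤ y.1 + y.2 ∧ y.1 + y.2 ≤ 1 then ∑ k ∈ Finset.Icc 1 6, (1 / (k.factorial : ℝ)) *
            cpow (fun t : ℝ => if (1651 / 10000 : ℝ) < t then 1 / t else 0) k (1 - (y.1 + y.2)) else 0) /
            (y.1 * y.2) ∂((volume : Measure ℝ).prod volume) := by
  have hJ : (tabJ : ℝ) = 120000 := by norm_num [tabJ]
  have hJpos : (0 : ℝ) < tabJ := by rw [hJ]; norm_num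
  obtain ⟨hab, hb, hj⟩ := certG2_le_of_mem he
  have hr' : r ∈ entryRects e.1 e.2.1 e.2.2.1 (decide (0 < e.2.2.2)) := by rw [decide_eq_true hc]; exact hr
  obtain ⟨h0u, hu, h0v, hv, hhi, hlo, hEa, hEa', hEb, hEb', hband⟩ := certRects_spec he hr'
  obtain ⟨hb1, hb0⟩ := hband hc
  have hEa_r : ((certEdge e.1 : ℚ) : ℝ) = ((19812 + e.1 * 283 : ℕ) : ℝ) / tabJ := by
    rw [certEdge_cast_of_le (by omega), hJ]; push_cast; ring
  have hEa1_r : ((certEdge (e.1 + 1) : ℚ) : ℝ) = ((19812 + e.1 * 283 + 283 : ℕ) : ℝ) / tabJ := by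
    rw [certEdge_cast_of_le (by omega), hJ]; push_cast; ring
  have hEb_r : ((certEdge e.2.1 : ℚ) : ℝ) = ((19812 + e.2.1 * 283 : ℕ) : ℝ) / tabJ := by
    rw [certEdge_cast_of_le (by omega), hJ]; push_cast; ring
  have hEb1_r : ((certEdge (e.2.1 + 1) : ℚ) : ℝ) = ((19812 + e.2.1 * 283 + 283 : ℕ) : ℝ) / tabJ := by
    rw [certEdge_cast_of_le (by omega), hJ]; push_cast; ring
  refine setIntegral_congr_off_lines {((certEdge e.1 : ℚ) : ℝ)} {((certEdge e.2.1 : ℚ) : ℝ)} {(8349 / 20000 : ℝ)}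
    (fun p hpA hpB hpC => ?_) _
  simp only [Finset.mem_singleton] at hpA hpB hpC
  constructor
  · intro hp
    refine ⟨hp, ?_⟩
    obtain ⟨⟨hp1, hp2⟩, ⟨hp3, hp4⟩⟩ := hp
    simp only [Set.mem_setOf_eq]
    -- casts of the integer side conditions, divided by `J`
    have c1 : ((19812 + e.1 * 283 : ℕ) : ℝ) / tabJ ≤ ((r.1 : ℕ) : ℝ) / tabJ :=
      div_le_div_of_nonneg_right (by exact_mod_cast hEa) hJpos.le
    have c2 : ((r.2.1 : ℕ) : ℝ) / tabJ ≤ ((19812 + e.1 * 283 + 283 : ℕ) : ℝ) / tabJ :=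
      div_le_div_of_nonneg_right (by exact_mod_cast hEa') hJpos.le
    have c3 : ((19812 + e.2.1 * 283 : ℕ) : ℝ) / tabJ ≤ ((r.2.2.1 : ℕ) : ℝ) / tabJ :=
      div_le_div_of_nonneg_right (by exact_mod_cast hEb) hJpos.le
    have c4 : ((r.2.2.2 : ℕ) : ℝ) / tabJ ≤ ((19812 + e.2.1 * 283 + 283 : ℕ) : ℝ) / tabJ :=
      div_le_div_of_nonneg_right (by exact_mod_cast hEb') hJpos.le
    have c5 : ((r.2.1 : ℕ) : ℝ) / tabJ + ((r.2.2.2 : ℕ) : ℝ) / tabJ ≤ 1 / 2 := by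
      rw [← add_div, div_le_iff₀ hJpos, hJ]
      have : ((r.2.1 : ℕ) : ℝ) + ((r.2.2.2 : ℕ) : ℝ) ≤ 60000 := by exact_mod_cast hhi
      linarith
    have hy1 : ((certEdge e.1 : ℚ) : ℝ) < p.1 := by
      rw [hEa_r] at hpA ⊢
      exact lt_of_le_of_ne (c1.trans hp1) (Ne.symm hpA)
    have hy2 : p.1 < ((certEdge (e.1 + 1) : ℚ) : ℝ) := by
      rw [hEa1_r]; exact lt_of_lt_of_le hp2 c2
    have hy3 : ((certEdge e.2.1 : ℚ) : ℝ) < p.2 := by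
      rw [hEb_r] at hpB ⊢
      exact lt_of_le_of_ne (c3.trans hp3) (Ne.symm hpB)
    have hy4 : p.2 < ((certEdge (e.2.1 + 1) : ℚ) : ℝ) := by
      rw [hEb1_r]; exact lt_of_lt_of_le hp4 c4
    have hy6 : p.1 + p.2 < 1 / 2 := by linarith
    refine ⟨hy1, hy2, hy3, hy4, ?_, hy6⟩
    by_cases hj0 : e.2.2.1 = 0
    · rw [if_pos hj0]
      have c6 : ((r.2.1 : ℕ) : ℝ) / tabJ + ((r.2.2.2 : ℕ) : ℝ) / tabJ ≤ 8349 / 20000 := by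
        rw [← add_div, div_le_iff₀ hJpos, hJ]
        have : ((r.2.1 : ℕ) : ℝ) + ((r.2.2.2 : ℕ) : ℝ) ≤ 50094 := by exact_mod_cast hb0 hj0
        linarith
      linarith
    · rw [if_neg hj0]
      have hj1 : e.2.2.1 = 1 := by omega
      have c7 : (8349 / 20000 : ℝ) ≤ ((r.1 : ℕ) : ℝ) / tabJ + ((r.2.2.1 : ℕ) : ℝ) / tabJ := by
        rw [← add_div, le_div_iff₀ hJpos, hJ]
        have : (50094 : ℝ) ≤ ((r.1 : ℕ) : ℝ) + ((r.2.2.1 : ℕ) : ℝ) := by exact_mod_cast hb1 hj1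
        linarith
      exact lt_of_le_of_ne (by linarith) (Ne.symm hpC)
  · intro hp; exact hp.1

/-- **The inner rectangle integrals of a positive entry add up to at most `∫_{S_e} f`.** [folklore] -/
theorem entryRects_integral_sum_le {e : ℕ × ℕ × ℕ × ℤ} (he : e ∈ certG2) (hc : 0 < e.2.2.2) :
    ((entryRects e.1 e.2.1 e.2.2.1 true).map fun r : ℕ × ℕ × ℕ × ℕ =>
      ∫ y in (Set.Ico ((r.1 : ℝ) / tabJ) ((r.2.1 : ℝ) / tabJ) ×ˢ Set.Ico ((r.2.2.1 : ℝ) / tabJ) ((r.2.2.2 : ℝ) / tabJ)),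
          (if 0 ≤ y.1 + y.2 ∧ y.1 + y.2 ≤ 1 then ∑ k ∈ Finset.Icc 1 6, (1 / (k.factorial : ℝ)) *
            cpow (fun t : ℝ => if (1651 / 10000 : ℝ) < t then 1 / t else 0) k (1 - (y.1 + y.2)) else 0) /
            (y.1 * y.2) ∂((volume : Measure ℝ).prod volume)).sum ≤
    ∫ y in {y : ℝ × ℝ | ((certEdge e.1 : ℚ) : ℝ) < y.1 ∧ y.1 < ((certEdge (e.1 + 1) : ℚ) : ℝ) ∧
      ((certEdge e.2.1 : ℚ) : ℝ) < y.2 ∧ y.2 < ((certEdge (e.2.1 + 1) : ℚ) : ℝ) ∧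
      (if e.2.2.1 = 0 then y.1 + y.2 < 8349 / 20000 else 8349 / 20000 < y.1 + y.2) ∧ y.1 + y.2 < 1 / 2},
          (if 0 ≤ y.1 + y.2 ∧ y.1 + y.2 ≤ 1 then ∑ k ∈ Finset.Icc 1 6, (1 / (k.factorial : ℝ)) *
            cpow (fun t : ℝ => if (1651 / 10000 : ℝ) < t then 1 / t else 0) k (1 - (y.1 + y.2)) else 0) /
            (y.1 * y.2) ∂((volume : Measure ℝ).prod volume) := by
  have hJpos : (0 : ℝ) < tabJ := by norm_num [tabJ]
  -- replace each rectangle by its part inside `S_e`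
  have hcongr : ((entryRects e.1 e.2.1 e.2.2.1 true).map fun r : ℕ × ℕ × ℕ × ℕ =>
      ∫ y in (Set.Ico ((r.1 : ℝ) / tabJ) ((r.2.1 : ℝ) / tabJ) ×ˢ Set.Ico ((r.2.2.1 : ℝ) / tabJ) ((r.2.2.2 : ℝ) / tabJ)),
          (if 0 ≤ y.1 + y.2 ∧ y.1 + y.2 ≤ 1 then ∑ k ∈ Finset.Icc 1 6, (1 / (k.factorial : ℝ)) *
            cpow (fun t : ℝ => if (1651 / 10000 : ℝ) < t then 1 / t else 0) k (1 - (y.1 + y.2)) else 0) /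
            (y.1 * y.2) ∂((volume : Measure ℝ).prod volume)) =
      ((entryRects e.1 e.2.1 e.2.2.1 true).map fun r : ℕ × ℕ × ℕ × ℕ =>
      ∫ y in (Set.Ico ((r.1 : ℝ) / tabJ) ((r.2.1 : ℝ) / tabJ) ×ˢ Set.Ico ((r.2.2.1 : ℝ) / tabJ) ((r.2.2.2 : ℝ) / tabJ)) ∩
        {y : ℝ × ℝ | ((certEdge e.1 : ℚ) : ℝ) < y.1 ∧ y.1 < ((certEdge (e.1 + 1) : ℚ) : ℝ) ∧
      ((certEdge e.2.1 : ℚ) : ℝ) < y.2 ∧ y.2 < ((certEdge (e.2.1 + 1) : ℚ) : ℝ) ∧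
      (if e.2.2.1 = 0 then y.1 + y.2 < 8349 / 20000 else 8349 / 20000 < y.1 + y.2) ∧ y.1 + y.2 < 1 / 2},
          (if 0 ≤ y.1 + y.2 ∧ y.1 + y.2 ≤ 1 then ∑ k ∈ Finset.Icc 1 6, (1 / (k.factorial : ℝ)) *
            cpow (fun t : ℝ => if (1651 / 10000 : ℝ) < t then 1 / t else 0) k (1 - (y.1 + y.2)) else 0) /
            (y.1 * y.2) ∂((volume : Measure ℝ).prod volume)) :=
    List.map_congr_left fun r hr => rect_integral_eq_inter he hc hr
  rw [hcongr]
  refine sum_setIntegral_le_of_subset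
    (fun r : ℕ × ℕ × ℕ × ℕ => (Set.Ico ((r.1 : ℝ) / tabJ) ((r.2.1 : ℝ) / tabJ) ×ˢ Set.Ico ((r.2.2.1 : ℝ) / tabJ) ((r.2.2.2 : ℝ) / tabJ)) ∩
        {y : ℝ × ℝ | ((certEdge e.1 : ℚ) : ℝ) < y.1 ∧ y.1 < ((certEdge (e.1 + 1) : ℚ) : ℝ) ∧
      ((certEdge e.2.1 : ℚ) : ℝ) < y.2 ∧ y.2 < ((certEdge (e.2.1 + 1) : ℚ) : ℝ) ∧
      (if e.2.2.1 = 0 then y.1 + y.2 < 8349 / 20000 else 8349 / 20000 < y.1 + y.2) ∧ y.1 + y.2 < 1 / 2})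
    (fun r => (measurableSet_Ico.prod measurableSet_Ico).inter (measurableSet_entrySq e))
    (measurableSet_entrySq e) (integrableOn_truncWeight_entrySq e) (fun y hy => ?_) _ ?_
    (fun r _ => Set.inter_subset_right)
  · simp only [Set.mem_setOf_eq] at hy
    have hy1 : (1651 / 10000 : ℝ) < y.1 := lt_of_le_of_lt (nu_le_certEdge e.1) hy.1
    have hy2 : (1651 / 10000 : ℝ) < y.2 := lt_of_le_of_lt (nu_le_certEdge e.2.1) hy.2.2.1
    exact truncWeight_nonneg y (by linarith) (by linarith)
  · exact (certRects_disjoint he true).imp fun {r s} h =>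
      (rect_disjoint_of_sep h).mono Set.inter_subset_left Set.inter_subset_left

/-- **A positive entry's contribution to `certP` is at most `D` times its plane pairing.** [folklore] -/
theorem entry_pos_sum_le {e : ℕ × ℕ × ℕ × ℤ} (he : e ∈ certG2) (hc : 0 < e.2.2.2) :
    ((((entryRects e.1 e.2.1 e.2.2.1 true).map
        (rectPos certBlockLo e.2.2.2.natAbs (if e.1 == e.2.1 then 2 else 1))).sum : ℕ) : ℝ) ≤
    (tabD : ℝ) * ∫ y : ℝ × ℝ, (if ((certEdge e.1 : ℚ) : ℝ) < y.1 ∧ y.1 < ((certEdge (e.1 + 1) : ℚ) : ℝ) ∧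
            ((certEdge e.2.1 : ℚ) : ℝ) < y.2 ∧ y.2 < ((certEdge (e.2.1 + 1) : ℚ) : ℝ) ∧
            y.1 ≤ y.2 ∧ (if e.2.2.1 = 0 then y.1 + y.2 < 8349 / 20000 else 8349 / 20000 < y.1 + y.2) ∧
            y.1 + y.2 < 1 / 2
        then (((e.2.2.2 : ℤ) : ℝ) / 1000000) * (∑ m ∈ Finset.Icc 1 6, (1 / (m.factorial : ℝ)) *
          cpow (fun t : ℝ => if (1651 / 10000 : ℝ) < t then 1 / t else 0) m (1 - (y.1 + y.2))) / (y.1 * y.2)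
        else 0) ∂((volume : Measure ℝ).prod volume) := by
  have hD : (0 : ℝ) < tabD := by norm_num [tabD]
  set σ : ℕ := (if e.1 == e.2.1 then 2 else 1) with hσdef
  have hσ : 0 < σ := by rw [hσdef]; split_ifs <;> norm_num
  have hσr : (0 : ℝ) < (σ : ℝ) := by exact_mod_cast hσ
  have hc' : ((e.2.2.2.natAbs : ℕ) : ℝ) = ((e.2.2.2 : ℤ) : ℝ) := by
    have h : ((e.2.2.2.natAbs : ℕ) : ℤ) = e.2.2.2 := Int.natAbs_of_nonneg hc.le
    conv_rhs => rw [← h]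
    simp only [Int.cast_natCast]
  -- per rectangle: `rectPos ≤ D · (c/10⁶/σ) · ∫_rect f`
  have hper : ∀ r ∈ entryRects e.1 e.2.1 e.2.2.1 true,
      ((rectPos certBlockLo e.2.2.2.natAbs σ r : ℕ) : ℝ) ≤
        (((e.2.2.2.natAbs : ℕ) : ℝ) / 1000000 / σ *
          ∫ y in (Set.Ico ((r.1 : ℝ) / tabJ) ((r.2.1 : ℝ) / tabJ) ×ˢ Set.Ico ((r.2.2.1 : ℝ) / tabJ) ((r.2.2.2 : ℝ) / tabJ)),
          (if 0 ≤ y.1 + y.2 ∧ y.1 + y.2 ≤ 1 then ∑ k ∈ Finset.Icc 1 6, (1 / (k.factorial : ℝ)) *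
            cpow (fun t : ℝ => if (1651 / 10000 : ℝ) < t then 1 / t else 0) k (1 - (y.1 + y.2)) else 0) /
            (y.1 * y.2) ∂((volume : Measure ℝ).prod volume)) * tabD := by
    intro r hr
    have hr' : r ∈ entryRects e.1 e.2.1 e.2.2.1 (decide (0 < e.2.2.2)) := by rw [decide_eq_true hc]; exact hr
    obtain ⟨h0u, hu, h0v, hv, hhi, hlo, -⟩ := certRects_spec he hr'
    obtain ⟨u0, u1, v0, v1⟩ := r
    exact (div_le_iff₀ hD).1 (rectPos_sound h0u hu.le h0v hv.le hhi hlo e.2.2.2.natAbs σ hσ)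
  rw [Nat.cast_list_sum, List.map_map]
  have hsum := List.sum_le_sum hper
  refine le_trans (by simpa only [Function.comp_def] using hsum) ?_
  rw [List.sum_map_mul_right, List.sum_map_mul_left]
  have hS := entryRects_integral_sum_le he hc
  rw [setIntegral_entrySq_eq he] at hS
  rw [plane_eq_mul_setIntegral, ← hc']
  have hQ0 : 0 ≤ ∫ y in {y : ℝ × ℝ | ((certEdge e.1 : ℚ) : ℝ) < y.1 ∧ y.1 < ((certEdge (e.1 + 1) : ℚ) : ℝ) ∧
      ((certEdge e.2.1 : ℚ) : ℝ) < y.2 ∧ y.2 < ((certEdge (e.2.1 + 1) : ℚ) : ℝ) ∧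
      y.1 ≤ y.2 ∧ (if e.2.2.1 = 0 then y.1 + y.2 < 8349 / 20000 else 8349 / 20000 < y.1 + y.2) ∧
      y.1 + y.2 < 1 / 2},
          (if 0 ≤ y.1 + y.2 ∧ y.1 + y.2 ≤ 1 then ∑ k ∈ Finset.Icc 1 6, (1 / (k.factorial : ℝ)) *
            cpow (fun t : ℝ => if (1651 / 10000 : ℝ) < t then 1 / t else 0) k (1 - (y.1 + y.2)) else 0) /
            (y.1 * y.2) ∂((volume : Measure ℝ).prod volume) := by
    refine setIntegral_nonneg (measurableSet_entryQ e) fun y hy => ?_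
    simp only [Set.mem_setOf_eq] at hy
    have hy1 : (1651 / 10000 : ℝ) < y.1 := lt_of_le_of_lt (nu_le_certEdge e.1) hy.1
    have hy2 : (1651 / 10000 : ℝ) < y.2 := lt_of_le_of_lt (nu_le_certEdge e.2.1) hy.2.2.1
    exact truncWeight_nonneg y (by linarith) (by linarith)
  have hcn : (0 : ℝ) ≤ ((e.2.2.2.natAbs : ℕ) : ℝ) / 1000000 / σ := by positivity
  calc ((e.2.2.2.natAbs : ℕ) : ℝ) / 1000000 / σ * ((entryRects e.1 e.2.1 e.2.2.1 true).map fun r : ℕ × ℕ × ℕ × ℕ =>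
        ∫ y in (Set.Ico ((r.1 : ℝ) / tabJ) ((r.2.1 : ℝ) / tabJ) ×ˢ Set.Ico ((r.2.2.1 : ℝ) / tabJ) ((r.2.2.2 : ℝ) / tabJ)),
          (if 0 ≤ y.1 + y.2 ∧ y.1 + y.2 ≤ 1 then ∑ k ∈ Finset.Icc 1 6, (1 / (k.factorial : ℝ)) *
            cpow (fun t : ℝ => if (1651 / 10000 : ℝ) < t then 1 / t else 0) k (1 - (y.1 + y.2)) else 0) /
            (y.1 * y.2) ∂((volume : Measure ℝ).prod volume)).sum * tabD
      ≤ ((e.2.2.2.natAbs : ℕ) : ℝ) / 1000000 / σ * ((σ : ℝ) * ∫ y in {y : ℝ × ℝ | ((certEdge e.1 : ℚ) : ℝ) < y.1 ∧ y.1 < ((certEdge (e.1 + 1) : ℚ) : ℝ) ∧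
      ((certEdge e.2.1 : ℚ) : ℝ) < y.2 ∧ y.2 < ((certEdge (e.2.1 + 1) : ℚ) : ℝ) ∧
      y.1 ≤ y.2 ∧ (if e.2.2.1 = 0 then y.1 + y.2 < 8349 / 20000 else 8349 / 20000 < y.1 + y.2) ∧
      y.1 + y.2 < 1 / 2},
          (if 0 ≤ y.1 + y.2 ∧ y.1 + y.2 ≤ 1 then ∑ k ∈ Finset.Icc 1 6, (1 / (k.factorial : ℝ)) *
            cpow (fun t : ℝ => if (1651 / 10000 : ℝ) < t then 1 / t else 0) k (1 - (y.1 + y.2)) else 0) /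
            (y.1 * y.2) ∂((volume : Measure ℝ).prod volume)) * tabD := by
        gcongr
    _ = (tabD : ℝ) * (((e.2.2.2.natAbs : ℕ) : ℝ) / 1000000 * ∫ y in {y : ℝ × ℝ | ((certEdge e.1 : ℚ) : ℝ) < y.1 ∧ y.1 < ((certEdge (e.1 + 1) : ℚ) : ℝ) ∧
      ((certEdge e.2.1 : ℚ) : ℝ) < y.2 ∧ y.2 < ((certEdge (e.2.1 + 1) : ℚ) : ℝ) ∧
      y.1 ≤ y.2 ∧ (if e.2.2.1 = 0 then y.1 + y.2 < 8349 / 20000 else 8349 / 20000 < y.1 + y.2) ∧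
      y.1 + y.2 < 1 / 2},
          (if 0 ≤ y.1 + y.2 ∧ y.1 + y.2 ≤ 1 then ∑ k ∈ Finset.Icc 1 6, (1 / (k.factorial : ℝ)) *
            cpow (fun t : ℝ => if (1651 / 10000 : ℝ) < t then 1 / t else 0) k (1 - (y.1 + y.2)) else 0) /
            (y.1 * y.2) ∂((volume : Measure ℝ).prod volume)) := by
        rw [← mul_assoc (((e.2.2.2.natAbs : ℕ) : ℝ) / 1000000 / σ), div_mul_cancel₀ _ hσr.ne']
        ring

end Summit.Parity.GeneralizedHardyLittlewood.FordMaynardSieveConst01651SieveConst01651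

end
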